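import Mathlib
import HarnessLib
import Summits.NavierStokesRegularity.NavierStokesRegularity.Theorems.CompletionRelayChainRelayFrontStepStubWake
import Summits.NavierStokesRegularity.NavierStokesRegularity.Theorems.CompletionRelayChainRelayFrontStepFlux

/-!
# `CompletionRelayChain` — crux `RelayFrontStep` (item stmt-NavierStokesRegularity-24850):
  THE FAR WAKE ON SHELL ENERGIES (helper for LINE `window_v2`, reshape v3: stub `stub_wake₃`)

Reshape v3 of the line replaces the per-mode wake clauses `F i k ≤ wakeE i k` of `W₂` by SHELL-energy
clauses `Σᵢ F i k ≤ wakeS k = ½·(1/4)·2^{−k}` (`k ≤ −1`): an adversarial screen (kit j300400) showed that the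
per-mode carrier clause is not re-entered at old shell `−1` (a negative wake carrier absorbs its own
trigger's energy, ratio 1.10), whereas the relay rows conserve each shell's energy up to the bond fluxes
(`RelayFrontStep.sum_quadTerm_mul_self_of_relayRows`: `Σᵢ quadTerm·S = Φ_{k−1} − Φ_k`,
`Φ_k = Λ_k u_k (u_k x_{k+1} + r_k u_{k+1}/32)`).

This file proves the far-wake statement for shell energies (`wake_shell_family_bound`, `wake_shell`): along
any pseudo-flow of a table with the relay rows, started with `Σᵢ F₀ i k ≤ ½·(1/4)·2^{−k}` for `k ≤ −1`, and
with old shell `−3` under the epoch envelope on `[0, τ₁]` (`τ₁ ≤ 8`), every old shell `j ≤ −4` keeps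
`Σᵢ F i j t ≤ (1 + t/20)·½·(1/4)·2^{−j}` (one-sided uniform bootstrap with slack `169/140` over the family
`{Σᵢ F i j}_{j ≤ −4}`; the shell power is the flux difference, `≤ 0.76/q²` with `q = 2^{|j|/2}` under the
bootstrap amplitude bounds `0.65q` (own shell), `0.92q` (shell below), `1.5q` (shell above), and
`0.76/q² ≤ (q²/8)/20` because `q⁴ ≥ 256`); hence the per-mode epoch envelope `relayEnv₂` on old shells
`≤ −4` and re-entry of the shell-energy clauses one shell deeper for any `a ≥ 17/20`. The clause profile is
written out (`½·(1/4)·2^{−k}`); the registered stub over the named profile `wakeS` is a one-line wrapper.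

No definitions. HONEST FRAMING: MODEL lattice only (Tao 2016 §4 vocabulary); helper for one registered stub
of an open crux; nothing here is a statement about the Navier–Stokes equations.
-/

noncomputable section

-- the summit-side namespace `Summit.NavierStokesRegularity.NavierStokesRegularity.…` (single-conjunct summit,
-- D-0017) repeats a component by design; the dupNamespace linter would flag every declaration.
set_option linter.dupNamespace false

open Set MeasureTheory intervalIntegral Literature.Analysis.FluidPDE Literature.Analysis.FluidPDE.TaoCascade
open Summit.NavierStokesRegularity.NavierStokesRegularity.Theorems
open Summit.NavierStokesRegularity.NavierStokesRegularity.Theorems.RelayFrontStep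
open Literature.Analysis.FluidPDE.WaveKinetic (abs_mul_three_le)

namespace Summit.NavierStokesRegularity.NavierStokesRegularity.Cruxes.RelayFrontStep.Window2

/-! ### Algebra: the flux difference under the bootstrap amplitude bounds -/

/-- FLUX RATE: with `Λ = q^{−5}`, `0 ≤ Λ' ≤ 0.177·q^{−5}`, own shell `|x|,|u|,|r| ≤ 0.65q`, shell below
`|u'|,|r'| ≤ 0.92q`, shell above `|x⁺|,|u⁺| ≤ 1.5q`:
`Λ'u'(u'x + r'u/32) − Λu(u x⁺ + r u⁺/32) ≤ 0.76/q²`. -/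
theorem wake_flux_rate {q Λ Λ' x u r u' r' xp up : ℝ} (hq : 0 < q) (hΛ : Λ = 1 / q ^ 5)
    (hΛ'0 : 0 ≤ Λ') (hΛ' : Λ' ≤ 177 / 1000 / q ^ 5) (hx : |x| ≤ 65 / 100 * q)
    (hu : |u| ≤ 65 / 100 * q) (hr : |r| ≤ 65 / 100 * q) (hu' : |u'| ≤ 92 / 100 * q)
    (hr' : |r'| ≤ 92 / 100 * q) (hxp : |xp| ≤ 15 / 10 * q) (hup : |up| ≤ 15 / 10 * q) :
    Λ' * u' * (u' * x + 1 / 32 * r' * u) - Λ * u * (u * xp + 1 / 32 * r * up) ≤ 76 / 100 / q ^ 2 := by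
  have hΛ0 : 0 ≤ Λ := by rw [hΛ]; positivity
  have h1 := abs_mul_three_le hu' hu' hx
  have h2 := abs_mul_three_le hu' hr' hu
  have h3 := abs_mul_three_le hu hu hxp
  have h4 := abs_mul_three_le hu hr hup
  have e1 : Λ' * (u' * u' * x) ≤ Λ' * (92 / 100 * q * (92 / 100 * q) * (65 / 100 * q)) :=
    mul_le_mul_of_nonneg_left ((le_abs_self _).trans h1) hΛ'0
  have e2 : 1 / 32 * (Λ' * (u' * r' * u)) ≤ 1 / 32 * (Λ' * (92 / 100 * q * (92 / 100 * q) * (65 / 100 * q))) := by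
    have := mul_le_mul_of_nonneg_left ((le_abs_self _).trans h2) hΛ'0
    linarith
  have e3 : -(Λ * (u * u * xp)) ≤ Λ * (65 / 100 * q * (65 / 100 * q) * (15 / 10 * q)) := by
    have := neg_abs_le (u * u * xp)
    nlinarith
  have e4 : -(1 / 32 * (Λ * (u * r * up))) ≤ 1 / 32 * (Λ * (65 / 100 * q * (65 / 100 * q) * (15 / 10 * q))) := by
    have := neg_abs_le (u * r * up)
    nlinarith
  have hq3 : Λ' * q ^ 3 ≤ 177 / 1000 / q ^ 2 := by
    calc Λ' * q ^ 3 ≤ 177 / 1000 / q ^ 5 * q ^ 3 := by gcongr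
      _ = 177 / 1000 / q ^ 2 := by field_simp
  calc Λ' * u' * (u' * x + 1 / 32 * r' * u) - Λ * u * (u * xp + 1 / 32 * r * up)
      = Λ' * (u' * u' * x) + 1 / 32 * (Λ' * (u' * r' * u)) + -(Λ * (u * u * xp)) +
          -(1 / 32 * (Λ * (u * r * up))) := by ring
    _ ≤ Λ' * (92 / 100 * q * (92 / 100 * q) * (65 / 100 * q)) +
          1 / 32 * (Λ' * (92 / 100 * q * (92 / 100 * q) * (65 / 100 * q))) +
          Λ * (65 / 100 * q * (65 / 100 * q) * (15 / 10 * q)) +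
          1 / 32 * (Λ * (65 / 100 * q * (65 / 100 * q) * (15 / 10 * q))) := by linarith
    _ = (33 / 32 * (92 / 100 * (92 / 100) * (65 / 100))) * (Λ' * q ^ 3) +
          (33 / 32 * (65 / 100 * (65 / 100) * (15 / 10))) / q ^ 2 := by
        rw [hΛ]; field_simp; ring
    _ ≤ (33 / 32 * (92 / 100 * (92 / 100) * (65 / 100))) * (177 / 1000 / q ^ 2) +
          (33 / 32 * (65 / 100 * (65 / 100) * (15 / 10))) / q ^ 2 := by gcongr
    _ = (33 / 32 * (92 / 100 * (92 / 100) * (65 / 100)) * (177 / 1000) +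
          33 / 32 * (65 / 100 * (65 / 100) * (15 / 10))) / q ^ 2 := by ring
    _ ≤ 76 / 100 / q ^ 2 := div_le_div_of_nonneg_right (by norm_num) (by positivity)

/-- CRUDE FLUX RATE: with all amplitudes `≤ M` and clocks `≤ 1`, the flux difference is `≤ 3M³`. -/
theorem wake_flux_crude {Λ Λ' x u r u' r' xp up M : ℝ} (hΛ0 : 0 ≤ Λ) (hΛ : Λ ≤ 1) (hΛ'0 : 0 ≤ Λ')
    (hΛ' : Λ' ≤ 1) (hx : |x| ≤ M) (hu : |u| ≤ M) (hr : |r| ≤ M) (hu' : |u'| ≤ M) (hr' : |r'| ≤ M)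
    (hxp : |xp| ≤ M) (hup : |up| ≤ M) :
    Λ' * u' * (u' * x + 1 / 32 * r' * u) - Λ * u * (u * xp + 1 / 32 * r * up) ≤ 3 * M ^ 3 := by
  have hM : 0 ≤ M := (abs_nonneg x).trans hx
  have h1 := abs_mul_three_le hu' hu' hx
  have h2 := abs_mul_three_le hu' hr' hu
  have h3 := abs_mul_three_le hu hu hxp
  have h4 := abs_mul_three_le hu hr hup
  have e1 : Λ' * (u' * u' * x) ≤ Λ' * (M * M * M) :=
    mul_le_mul_of_nonneg_left ((le_abs_self _).trans h1) hΛ'0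
  have e2 : 1 / 32 * (Λ' * (u' * r' * u)) ≤ 1 / 32 * (Λ' * (M * M * M)) := by
    have := mul_le_mul_of_nonneg_left ((le_abs_self _).trans h2) hΛ'0
    linarith
  have e3 : -(Λ * (u * u * xp)) ≤ Λ * (M * M * M) := by
    have := neg_abs_le (u * u * xp)
    nlinarith
  have e4 : -(1 / 32 * (Λ * (u * r * up))) ≤ 1 / 32 * (Λ * (M * M * M)) := by
    have := neg_abs_le (u * r * up)
    nlinarith
  have hM3 : 0 ≤ M * M * M := by positivity
  calc Λ' * u' * (u' * x + 1 / 32 * r' * u) - Λ * u * (u * xp + 1 / 32 * r * up)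
      = Λ' * (u' * u' * x) + 1 / 32 * (Λ' * (u' * r' * u)) + -(Λ * (u * u * xp)) +
          -(1 / 32 * (Λ * (u * r * up))) := by ring
    _ ≤ Λ' * (M * M * M) + 1 / 32 * (Λ' * (M * M * M)) + Λ * (M * M * M) +
          1 / 32 * (Λ * (M * M * M)) := by linarith
    _ ≤ 1 * (M * M * M) + 1 / 32 * (1 * (M * M * M)) + 1 * (M * M * M) +
          1 / 32 * (1 * (M * M * M)) := by gcongr
    _ ≤ 3 * M ^ 3 := by nlinarith

/-! ### The flow part -/

variable {τ κ₁ κ₂ : ℝ} {α : Fin 4 → Fin 4 → Fin 4 → ℤ × ℤ × ℤ → ℝ}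
  {S₀ F₀ B₀ : Fin 4 → ℤ → ℝ} {S F : Fin 4 → ℤ → ℝ → ℝ}

/-- **Shell power = flux difference** along the flow (the row identity of
`RelayFrontStep.sum_quadTerm_mul_self_of_relayRows`, restated for the flow's amplitudes). -/
theorem shell_power_eq (hrows : RelayRows α) (k : ℤ) (s : ℝ) :
    ∑ i, quadTerm 1 α S i k s * S i k s =
      (1 + 1 : ℝ) ^ ((5 : ℝ) * ((k : ℝ) - 1) / 2) * S 1 (k - 1) s *
          (S 1 (k - 1) s * S 0 k s + (1 / 32 : ℝ) * S 2 (k - 1) s * S 1 k s) -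
        (1 + 1 : ℝ) ^ ((5 : ℝ) * (k : ℝ) / 2) * S 1 k s *
          (S 1 k s * S 0 (k + 1) s + (1 / 32 : ℝ) * S 2 k s * S 1 (k + 1) s) :=
  sum_quadTerm_mul_self_of_relayRows hrows S k s

/-- **Shell-energy increment on a sub-interval**: if the shell power `Σᵢ quadTerm·S` of shell `k` is
`≤ C` on `[s, t] ⊆ [0, τ]`, then `Σᵢ F i k t − Σᵢ F i k s ≤ C·(t − s)`.
[cite: Tao2016AveragedNS, §4 Lemma 4.1 (4.9)] -/
theorem pseudoFlowOn_shell_increment_le_const (h : PseudoFlowOn τ 1 α κ₁ κ₂ S₀ F₀ B₀ S F) (hτ : 0 < τ)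
    (k : ℤ) {s t C : ℝ} (hs : 0 ≤ s) (hst : s ≤ t) (ht : t ≤ τ)
    (hC : ∀ u ∈ Icc s t, ∑ i, quadTerm 1 α S i k u * S i k u ≤ C) :
    ∑ i, F i k t - ∑ i, F i k s ≤ C * (t - s) := by
  have hsub : uIcc s t ⊆ Icc 0 τ := by rw [uIcc_of_le hst]; exact Icc_subset_Icc hs ht
  have hint : ∀ i, IntervalIntegrable (fun u => quadTerm 1 α S i k u * S i k u) volume s t := fun i =>
    ((pseudoFlowOn_continuousOn_quadTerm_mul h i k).mono hsub).intervalIntegrable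
  have h1 : ∀ i, F i k t - F i k s ≤ ∫ u in s..t, quadTerm 1 α S i k u * S i k u := fun i =>
    pseudoFlowOn_energy_increment_le h hτ i k hs hst ht
  have h2 : ∑ i, (F i k t - F i k s) ≤ ∑ i, ∫ u in s..t, quadTerm 1 α S i k u * S i k u :=
    Finset.sum_le_sum fun i _ => h1 i
  rw [← intervalIntegral.integral_finsetSum (fun i _ => hint i)] at h2
  have hint' : IntervalIntegrable (fun u => ∑ i, quadTerm 1 α S i k u * S i k u) volume s t :=
    (continuousOn_finsetSum _ fun i _ => (pseudoFlowOn_continuousOn_quadTerm_mul h i k).mono hsub)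
      |>.intervalIntegrable
  have h3 : (∫ u in s..t, ∑ i, quadTerm 1 α S i k u * S i k u) ≤ ∫ u in s..t, C :=
    intervalIntegral.integral_mono_on hst hint' (by simp) fun u hu => hC u hu
  rw [intervalIntegral.integral_const, smul_eq_mul] at h3
  rw [Finset.sum_sub_distrib] at h2
  linarith

/-- CRUDE SHELL RATE along the flow: with every amplitude `≤ M`, at and below the front (`j ≤ 0`) the
shell power is `≤ 3M³`. [cite: Tao2016AveragedNS, §4 Lemma 4.1 (4.5), (4.9)] -/
theorem wake_shell_crude_rate (hrows : RelayRows α)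
    {M : ℝ} (hM : ∀ s ∈ Icc 0 τ, ∀ (i : Fin 4) (k : ℤ), |S i k s| ≤ M)
    {j : ℤ} (hj : j ≤ 0) {s : ℝ} (hs : s ∈ Icc 0 τ) :
    ∑ i, quadTerm 1 α S i j s * S i j s ≤ 3 * M ^ 3 := by
  rw [shell_power_eq hrows]
  have hΛ0 : 0 ≤ (1 + 1 : ℝ) ^ ((5 : ℝ) * (j : ℝ) / 2) := (Real.rpow_pos_of_pos (by norm_num) _).le
  have hΛ'0 : 0 ≤ (1 + 1 : ℝ) ^ ((5 : ℝ) * ((j : ℝ) - 1) / 2) :=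
    (Real.rpow_pos_of_pos (by norm_num) _).le
  exact wake_flux_crude hΛ0 (wake_clock_le_one hj) hΛ'0 (wake_clock_pred_le_one hj) (hM s hs 0 j)
    (hM s hs 1 j) (hM s hs 2 j) (hM s hs 1 (j - 1)) (hM s hs 2 (j - 1)) (hM s hs 0 (j + 1))
    (hM s hs 1 (j + 1))

/-- FINE SHELL RATE under the family hypothesis: if on `[0, t]` every wake shell energy `Σᵢ F i j'`
(`j' ≤ −4`) is `≤ 1.69·(1/8)·2^{−j'}` and old shell `−3` carries `≤ 16` per active mode, then for
`j ≤ −4`, `s ∈ [0, t]`: `Σᵢ quadTerm·S ≤ ((1/8)·2^{−j})/20`.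
[cite: Tao2016AveragedNS, §4 Lemma 4.1 (4.9), (4.10)] -/
theorem wake_shell_fine_rate (h : PseudoFlowOn τ 1 α κ₁ κ₂ S₀ F₀ B₀ S F) (hrows : RelayRows α)
    {t : ℝ} (ht : t ∈ Icc 0 τ)
    (hfam : ∀ j : ℤ, j ≤ -4 → ∀ s ∈ Icc 0 t, ∑ i, F i j s ≤ 169 / 100 * ((1 / 8) * (2 : ℝ) ^ (-(j : ℝ))))
    (h3 : ∀ s ∈ Icc 0 t, ∀ i : Fin 4, i ≠ 3 → F i (-3) s ≤ 16)
    {j : ℤ} (hj : j ≤ -4) {s : ℝ} (hs : s ∈ Icc 0 t) :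
    ∑ i, quadTerm 1 α S i j s * S i j s ≤ (1 / 8) * (2 : ℝ) ^ (-(j : ℝ)) / 20 := by
  have hsτ : s ∈ Icc 0 τ := ⟨hs.1, hs.2.trans ht.2⟩
  set q : ℝ := (2 : ℝ) ^ (-(j : ℝ) / 2) with hq_def
  have hq : 0 < q := Real.rpow_pos_of_pos (by norm_num) _
  have hq2 : q ^ 2 = (2 : ℝ) ^ (-(j : ℝ)) := wake_scale_sq j
  have hQ16 : 16 ≤ q ^ 2 := by rw [hq2]; exact wake_scale_sq_ge hj
  have hΛ : (1 + 1 : ℝ) ^ ((5 : ℝ) * (j : ℝ) / 2) = 1 / q ^ 5 := wake_clock_eq j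
  have hΛ'0 : 0 ≤ (1 + 1 : ℝ) ^ ((5 : ℝ) * ((j : ℝ) - 1) / 2) :=
    (Real.rpow_pos_of_pos (by norm_num) _).le
  have hΛ' : (1 + 1 : ℝ) ^ ((5 : ℝ) * ((j : ℝ) - 1) / 2) ≤ 177 / 1000 / q ^ 5 := by
    rw [wake_clock_pred_eq j]
    have h5 : 0 ≤ 1 / q ^ 5 := by positivity
    calc (2 : ℝ) ^ (-(5 : ℝ) / 2) * (1 / q ^ 5) ≤ 177 / 1000 * (1 / q ^ 5) :=
        mul_le_mul_of_nonneg_right two_rpow_neg_five_halves_le h5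
      _ = 177 / 1000 / q ^ 5 := by ring
  -- single energies of a family shell are below the shell sum
  have hsingle : ∀ (i : Fin 4) (j' : ℤ), j' ≤ -4 → F i j' s ≤ 169 / 100 * ((1 / 8) * (2 : ℝ) ^ (-(j' : ℝ))) := by
    intro i j' hj'
    have h1 : F i j' s ≤ ∑ i', F i' j' s :=
      Finset.single_le_sum (f := fun i' => F i' j' s) (fun i' _ => h.nonneg_F i' j' s hsτ) (Finset.mem_univ i)
    exact h1.trans (hfam j' hj' s hs)
  -- own shell: |S i j| ≤ 0.65 q
  have hown : ∀ i : Fin 4, |S i j s| ≤ 65 / 100 * q := by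
    intro i
    refine abs_le_of_sq_le_sq ?_ (by positivity)
    have h1 := hsingle i j hj
    have hd := h.defect_lower i j s hsτ
    rw [mul_pow, hq2]; nlinarith
  -- shell below (j - 1 ≤ -5): |S i (j-1)| ≤ 0.92 q
  have hbelow : ∀ i : Fin 4, |S i (j - 1) s| ≤ 92 / 100 * q := by
    intro i
    refine abs_le_of_sq_le_sq ?_ (by positivity)
    have h1 := hsingle i (j - 1) (by omega)
    have hd := h.defect_lower i (j - 1) s hsτ
    rw [wake_scale_sq_pred, ← hq2] at h1
    have hq2' : 0 ≤ q ^ 2 := sq_nonneg q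
    rw [mul_pow]; nlinarith
  -- shell above: old shell -3 if j = -4, a family shell otherwise; modes 0 and 1 only
  have hup : ∀ i : Fin 4, i ≠ 3 → |S i (j + 1) s| ≤ 15 / 10 * q := by
    intro i hi
    refine abs_le_of_sq_le_sq ?_ (by positivity)
    rw [mul_pow]
    by_cases hj4 : j = -4
    · have hF := h3 s hs i hi
      have hd := h.defect_lower i (-3) s hsτ
      have hj3 : j + 1 = -3 := by omega
      rw [hj3]
      nlinarith
    · have hj5 : j + 1 ≤ -4 := by omega
      have h1 := hsingle i (j + 1) hj5
      have hd := h.defect_lower i (j + 1) s hsτ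
      rw [wake_scale_sq_succ, ← hq2] at h1
      have hq2' : 0 ≤ q ^ 2 := sq_nonneg q
      nlinarith
  have hq4 : 256 ≤ q ^ 2 * q ^ 2 := by nlinarith
  have hq2pos : 0 < q ^ 2 := by positivity
  rw [shell_power_eq hrows, ← hq2]
  refine (wake_flux_rate hq hΛ hΛ'0 hΛ' (hown 0) (hown 1) (hown 2) (hbelow 1) (hbelow 2)
    (hup 0 (by decide)) (hup 1 (by decide))).trans ?_
  rw [div_le_iff₀ hq2pos]
  nlinarith

/-- **THE WAKE FAMILY BOUND ON SHELL ENERGIES.** Along any pseudo-flow (`ε₀ = 1`, any defect constants)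
of a table with the relay rows, started with the shell-energy wake clauses `Σᵢ F₀ i k ≤ (1/8)·2^{−k}`
(`k ≤ −1`), and with old shell `−3` under the epoch envelope on `[0, τ₁]` (`τ₁ ≤ 8`): for every old shell
`j ≤ −4`, `Σᵢ F i j t ≤ (1 + t/20)·(1/8)·2^{−j}` on `[0, τ₁]` (one-sided uniform bootstrap, slack `169/140`).
[cite: Tao2016AveragedNS, §4 Lemma 4.1 (4.5), (4.9), (4.10)] -/
theorem wake_shell_family_bound (h : PseudoFlowOn τ 1 α κ₁ κ₂ S₀ F₀ B₀ S F) (hτ : 0 < τ)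
    (hrows : RelayRows α)
    (hwake : ∀ k : ℤ, k ≤ -1 → ∑ i, F₀ i k ≤ (1 / 8) * (2 : ℝ) ^ (-(k : ℝ)))
    {τ₁ : ℝ} (hτ₁ : τ₁ ∈ Icc 0 τ) (hτ₁8 : τ₁ ≤ 8)
    (h3 : ∀ s ∈ Icc (0 : ℝ) τ₁, ∀ i : Fin 4, i ≠ 3 → F i (-3) s ≤ relayEnv₂ (-3)) :
    ∀ j : ℤ, j ≤ -4 → ∀ t ∈ Icc (0 : ℝ) τ₁,
      ∑ i, F i j t ≤ (1 + t / 20) * ((1 / 8) * (2 : ℝ) ^ (-(j : ℝ))) := by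
  obtain ⟨M, hM0, hM⟩ := wake_apriori_abs h
  let ι := {j : ℤ // j ≤ -4}
  have hp0 : ∀ j : ℤ, 0 ≤ (1 / 8) * (2 : ℝ) ^ (-(j : ℝ)) := fun j => by positivity
  have hgrow : ∀ x : ι, ∀ s ∈ Icc (0 : ℝ) τ₁, ∀ t ∈ Icc (0 : ℝ) τ₁, s ≤ t →
      ∑ i, F i x.1 t - ∑ i, F i x.1 s ≤ 24 * M ^ 3 * ((1 / 8) * (2 : ℝ) ^ (-(x.1 : ℝ))) * (t - s) := by
    rintro ⟨j, hj⟩ s hs t ht hst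
    have hQ1 := wake_scale_sq_ge_one (show j ≤ 0 by omega)
    have hM3 : 0 ≤ 3 * M ^ 3 := by positivity
    have hL : 3 * M ^ 3 ≤ 24 * M ^ 3 * ((1 / 8) * (2 : ℝ) ^ (-(j : ℝ))) := by nlinarith
    refine pseudoFlowOn_shell_increment_le_const h hτ j hs.1 hst (ht.2.trans hτ₁.2) fun u hu => ?_
    have huτ : u ∈ Icc 0 τ := ⟨hs.1.trans hu.1, hu.2.trans (ht.2.trans hτ₁.2)⟩
    exact (wake_shell_crude_rate hrows hM (by omega) huτ).trans hL
  have h0 : ∀ x : ι, ∑ i, F i x.1 0 ≤ (1 + 0 / 20) * ((1 / 8) * (2 : ℝ) ^ (-(x.1 : ℝ))) := by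
    rintro ⟨j, hj⟩
    simp only [zero_div, add_zero, one_mul]
    have : ∑ i, F i j 0 = ∑ i, F₀ i j := Finset.sum_congr rfl fun i _ => h.init_F i j
    rw [this]
    exact hwake j (by omega)
  have himp : ∀ t ∈ Icc (0 : ℝ) τ₁,
      (∀ x : ι, ∀ s ∈ Icc (0 : ℝ) t,
        ∑ i, F i x.1 s ≤ 169 / 140 * (1 + s / 20) * ((1 / 8) * (2 : ℝ) ^ (-(x.1 : ℝ)))) →
        ∀ x : ι, ∑ i, F i x.1 t ≤ (1 + t / 20) * ((1 / 8) * (2 : ℝ) ^ (-(x.1 : ℝ))) := by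
    rintro t ht hweak ⟨j, hj⟩
    have htτ : t ∈ Icc 0 τ := ⟨ht.1, ht.2.trans hτ₁.2⟩
    have hfam : ∀ j' : ℤ, j' ≤ -4 → ∀ s ∈ Icc 0 t,
        ∑ i, F i j' s ≤ 169 / 100 * ((1 / 8) * (2 : ℝ) ^ (-(j' : ℝ))) := by
      intro j' hj' s hs
      have h1 : ∑ i, F i j' s ≤ 169 / 140 * (1 + s / 20) * ((1 / 8) * (2 : ℝ) ^ (-(j' : ℝ))) :=
        hweak ⟨j', hj'⟩ s hs
      have hs8 : s ≤ 8 := hs.2.trans (ht.2.trans hτ₁8)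
      have h2 : 169 / 140 * (1 + s / 20) ≤ 169 / 100 := by linarith
      exact h1.trans (mul_le_mul_of_nonneg_right h2 (hp0 j'))
    have h3' : ∀ s ∈ Icc 0 t, ∀ i : Fin 4, i ≠ 3 → F i (-3) s ≤ 16 := fun s hs i hi =>
      relayEnv₂_neg_three ▸ h3 s ⟨hs.1, hs.2.trans ht.2⟩ i hi
    have hrate : ∀ u ∈ Icc 0 t, ∑ i, quadTerm 1 α S i j u * S i j u ≤
        (1 / 8) * (2 : ℝ) ^ (-(j : ℝ)) / 20 :=
      fun u hu => wake_shell_fine_rate h hrows htτ hfam h3' hj hu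
    have hinc := pseudoFlowOn_shell_increment_le_const h hτ j le_rfl ht.1 htτ.2 hrate
    have hF0 : ∑ i, F i j 0 = ∑ i, F₀ i j := Finset.sum_congr rfl fun i _ => h.init_F i j
    rw [hF0] at hinc
    have h00 := hwake j (by omega)
    show ∑ i, F i j t ≤ (1 + t / 20) * ((1 / 8) * (2 : ℝ) ^ (-(j : ℝ)))
    linarith
  have hψc : ContinuousOn (fun t : ℝ => 1 + t / 20) (Icc 0 τ₁) := by fun_prop
  have hψpos : ∀ t ∈ Icc (0 : ℝ) τ₁, 0 < 1 + t / 20 := fun t ht => by linarith [ht.1]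
  have key := bootstrap_family_oneSided_slack (u := fun x : ι => fun t => ∑ i, F i x.1 t)
    (p := fun x : ι => (1 / 8) * (2 : ℝ) ^ (-(x.1 : ℝ))) (ψ := fun t : ℝ => 1 + t / 20) (τ := τ₁)
    (L := 24 * M ^ 3) (θ := 169 / 140) (by norm_num) (fun x => hp0 x.1)
    (by positivity) hψc hψpos hgrow h0 himp
  intro j hj t ht
  exact key ⟨j, hj⟩ t ht

/-- **THE FAR WAKE ON SHELL ENERGIES** (clause profile written out; the registered stub `stub_wake₃` over the
named profile `wakeS` is its one-line wrapper): along any `(η,η)`-pseudo-flow of a table with the relay rows,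
started with `Σᵢ F₀ i k ≤ (1/8)·2^{−k}` for `k ≤ −1` and with old shell `−3` under the epoch envelope on the
hop window `[0, τ₁]` (`τ₁ ≤ 8`): the energies of the old shells `k ≤ −4` stay under `relayEnv₂`, and the
shell-energy wake clauses re-enter one shell deeper (`k ≤ −5`) after rescaling by any `a ≥ 17/20`.
MODEL lattice; nothing about the Navier–Stokes equations. -/
theorem wake_shell (h : PseudoFlowOn τ 1 α κ₁ κ₂ S₀ F₀ B₀ S F) (hτ : 0 < τ) (hrows : RelayRows α)
    (hwake : ∀ k : ℤ, k ≤ -1 → ∑ i, F₀ i k ≤ (1 / 8) * (2 : ℝ) ^ (-(k : ℝ)))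
    {τ₁ : ℝ} (hτ₁ : τ₁ ∈ Icc 0 τ) (hτ₁8 : τ₁ ≤ 8)
    (h3 : ∀ s ∈ Icc (0 : ℝ) τ₁, ∀ i : Fin 4, i ≠ 3 → F i (-3) s ≤ relayEnv₂ (-3)) :
    (∀ s ∈ Icc (0 : ℝ) τ₁, ∀ (i : Fin 4) (k : ℤ), k ≤ -4 → i ≠ 3 → F i k s ≤ relayEnv₂ k) ∧
    ∀ a : ℝ, 17 / 20 ≤ a →
      ∀ k : ℤ, k ≤ -5 → (∑ i, F i (1 + k) τ₁) / a ^ 2 ≤ (1 / 8) * (2 : ℝ) ^ (-(k : ℝ)) := by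
  have key := wake_shell_family_bound h hτ hrows hwake hτ₁ hτ₁8 h3
  have hsub : Icc 0 τ₁ ⊆ Icc 0 τ := Icc_subset_Icc_right hτ₁.2
  refine ⟨?_, ?_⟩
  · intro s hs i k hk _
    have h1 := key k hk s hs
    have hs8 : s ≤ 8 := hs.2.trans hτ₁8
    have hQ : 0 < (2 : ℝ) ^ (-(k : ℝ)) := Real.rpow_pos_of_pos (by norm_num) _
    have henv : relayEnv₂ k = 2 * (2 : ℝ) ^ (-(k : ℝ)) := by
      unfold relayEnv₂; rw [if_pos (by omega)]
    have hsingle : F i k s ≤ ∑ i', F i' k s :=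
      Finset.single_le_sum (f := fun i' => F i' k s) (fun i' _ => h.nonneg_F i' k s (hsub hs))
        (Finset.mem_univ i)
    rw [henv]
    have h2 : (1 + s / 20) * ((1 / 8) * (2 : ℝ) ^ (-(k : ℝ))) ≤ 14 / 10 * ((1 / 8) * (2 : ℝ) ^ (-(k : ℝ))) :=
      mul_le_mul_of_nonneg_right (by linarith) (by positivity)
    linarith
  · intro a ha k hk
    have h1 := key (1 + k) (by omega) τ₁ ⟨hτ₁.1, le_rfl⟩
    have ha2 : 289 / 400 ≤ a ^ 2 := by nlinarith
    have hpos : 0 < a ^ 2 := by positivity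
    rw [div_le_iff₀ hpos]
    rw [show (1 + k : ℤ) = k + 1 by ring, wake_scale_sq_succ] at h1
    have hQ : 0 < (2 : ℝ) ^ (-(k : ℝ)) := Real.rpow_pos_of_pos (by norm_num) _
    have h2 : (1 + τ₁ / 20) * ((1 / 8) * ((2 : ℝ) ^ (-(k : ℝ)) / 2)) ≤
        14 / 10 * ((1 / 8) * ((2 : ℝ) ^ (-(k : ℝ)) / 2)) :=
      mul_le_mul_of_nonneg_right (by linarith) (by positivity)
    rw [show (1 + k : ℤ) = k + 1 by ring]
    nlinarith

end Summit.NavierStokesRegularity.NavierStokesRegularity.Cruxes.RelayFrontStep.Window2
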